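/-
Copyright: lit-balaban cell, Phase-2 proof seat p11 (gen 2).  Statement-level skeleton of a published paper; no proof claims beyond
what the kernel checks below.
-/
import Literature.MathematicalPhysics.QuantumFieldTheory.BalabanImbrieJaffe1984to88.BIJ85ScalarForm464
import Literature.MathematicalPhysics.QuantumFieldTheory.BalabanImbrieJaffe1984to88.BIJ85BlockAveragesTorus

/-!
# `BalabanImbrieJaffe1984to88.BIJ85ScalarPropagatorTorus` — T. Bałaban, J. Imbrie, A. Jaffe, *Renormalization of the Higgs model:
minimizers, propagators and the stability of mean field theory*, Commun. Math. Phys. **97** (1985) 299–329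
[BalabanImbrieJaffe1985]: Sect. 4.6 p. 313 **(4.6.1)–(4.6.4)** and Sect. 3 p. 308 **(3.24)–(3.28)** ON THE TORUS CARRIER OF RECORD —
the invertibility behind *"Since no restrictions on φ occur in the Gaussian integral (4.6.1), we can also write G_k(u_k) =
[−Δ_{u_k} + a_kQ_k^*(u_k)Q_k(u_k)]^{−1} (4.6.2)"* PROVED for the PRINTED covariant block average (2.6) and covariant derivative, and
the abstract theorems of `BIJ85Eq461Proof` (seat p30) / `BIJ85ScalarForm464` (seat p11) INSTANTIATED on it

statement-level skeleton of published theorems with citation tags; proofs where landed; nothing here is a claim about the Yang–Mills mass gap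

PDF held: `paper:balaban1985-cmp97-bij-higgs-minimizers` (journal page = PDF page + 298).  Pages read as images: p. 303 [PDF 5]
(block averages), p. 308 [PDF 10], p. 313 [PDF 15] (`run/shared/lean/pub/lit-balaban/lit-balaban-p08/renders/bij85-p015.png`).

CITATION HEADER (lean-in-tree rule).  Phase-2 file of the lit-balaban TYPED SKELETON (HOME `run/shared/lean/pub/lit-balaban/`),
MODEL INSTANCE of rows **C1.Eq4.6.1** (`proved p245551`, seat p30 g2: (4.6.1) for G = [D^*D + a_kQ^*Q]^{−1} under the
convergence hypothesis `hpos`), **C1.Eq4.6.2-4.6.4** and **C1.Eq3.24-3.28** (p248398, this seat: (3.27)/(3.28)/(4.6.4) over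
abstract carriers, G a right inverse `hG`), seat p11 gen 2 (unit `lit-balaban-p11-g2`), TAKING line HOME/STATUS.md
2026-08-21T04:41:38Z; owner r15, referee ref-5.

THE PRINTED TEXT, verbatim (p. 313 [PDF 15]): *"The fundamental propagator G_k(u_k) for the scalar field in this theory can also
be defined by a functional integral, exp(½⟨h, G_k(u_k)h⟩) = Z_k(u_k)^{−1}∫𝒟φ exp[−½‖D_{u_k}φ‖² − ½a_k‖Q_k(u_k)φ‖² + ⟨φ, h⟩].
(4.6.1) Since no restrictions on φ occur in the Gaussian integral (4.6.1), we can also write G_k(u_k) = [−Δ_{u_k} +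
a_kQ_k^*(u_k)Q_k(u_k)]^{−1}, (4.6.2) where −Δ_{u_k} = D^*_{u_k}D_{u_k}. (4.6.3) … Δ_k(u_k) = a_kI − a_k²Q_k(u_k)G_k(u_k)Q_k^*(u_k).
(4.6.4) The scalar field action depends on the unit lattice field ψ through the η-lattice minimizer ψ_k, where ψ_k =
a_kG_k(u_k)Q_k^*(u_k)ψ."*; p. 300 (1.1): *"The covariant derivative D_uφ is defined by (D_uφ)_b = u_bφ_{b₊} − φ_{b₋}"*; p. 303
(2.6): *"(Qφ)_y = L^{−d} Σ_{x∈B(y)} u(Γ_{yx})φ_x"*.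

WHAT IS PROVED HERE (0 `sorry`, standard axioms, no `def … : Prop`).  Carriers: the fine torus `Balaban1983to89.Site P j` (the
η-lattice of §4.6; at k = 1 the unit lattice of §3 after the rescaling *"G₁ = S_L^*GS_L = G₁(u₁)"* of p. 308), the coarse torus
`Site P (j+1)` (the unit lattice of §4.6), positively oriented bonds `PBond P j`; a `U(1)` gauge field `U : GaugeField P j U1`
(`BIJ88Sect3Statements.U1`, read in `ℂ` by `cfg U b = toC (U b)`); the covariant derivative `BIJ88Sect3Statements.covD c (cfg U) φ b
= c(u_bφ(b₊) − φ(b₋))` (c = the lattice constant of the difference quotient, `c² = η^{d−2}` absorbs the (2.2) weight of the bond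
sum; only `c ≠ 0` is used); the ONE-LEVEL covariant block average (2.6) `BIJ85BlockAveragesTorus.qCov U φ y = L^{−d}Σ_{x∈B(y)}
u(Γ_{yx})φ(x)` of seat r18 (standard contours `Γ_{yx}` (2.4)–(2.5), transports `holC`).
* §1 TRANSPORT: if `D_uφ = 0` then `u(Γ_{yx})φ(x) = φ(y)` for the corner `y` of the block of `x` (`holC_mul_eq_corner`, leg by leg
  `prod_legBond_mul_eq`), hence `(Q(u)φ)(y) = φ(y)` (`qCov_eq_corner`, `|B(y)| = L^d`), hence **NO ZERO MODES**: `D_uφ = 0 ∧ Q(u)φ = 0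
  ⇒ φ = 0` (`eq_zero_of_covD_eq_zero_of_qCov_eq_zero`) — for EVERY gauge field u (no small-field or gauge condition).
* §2 PACKAGING as finite-dimensional real inner-product spaces (`PiLp 2`, the ℓ² products `Re Σ conj(φ)φ′`): `Dlin c U : FineSp →ₗ[ℝ]
  BondSp`, `Qlin U : FineSp →ₗ[ℝ] CoarseSp`, with `norm_Dlin_sq`, `norm_Qlin_sub_sq` identifying `BIJ85ScalarForm464.scalarForm (Dlin c U)
  (Qlin U) a ψ φ` with the printed exponent ½a Σ_y|(Q(u)φ)(y) − ψ(y)|² + ½Σ_b|c(u_bφ(b₊) − φ(b₋))|² (`scalarForm_torus`).  WEIGHTS (2.2):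
  the unit-lattice product has weight 1 (= `CoarseSp`); the bond weight sits in `c`; the η-lattice weight η^d of `⟨φ, φ′⟩` enters the
  printed objects only through adjoints and the source pairing of (4.6.1) — the functional, its minimizer ψ_k = aGQ^*ψ, the operator
  QGQ^* of (4.6.4) and the invertibility statement are the same in either product (G_printed = η^dG, Q^*_printed = η^{−d}Q^*, h_printed =
  η^{−d}h in `eq461_torus`).
* §3 **`hpos_torus`**: `φ ≠ 0 → 0 < ‖D_uφ‖² + a‖Q(u)φ‖²` (a > 0, c ≠ 0, standing range) = the hypothesis `hpos` of
  `BIJ85Eq461Proof.exists_inverse`/`eq461`/`eq462` and of `BIJ85ScalarForm464.eq_phiCl_of_isMinOn` DISCHARGED; whence, BY NAME: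
  **`exists_G`** ((4.6.2)/(3.26): G = [D_u^*D_u + aQ(u)^*Q(u)]^{−1} exists as a two-sided inverse), **`eq461_torus`** ((4.6.1) for the printed
  exponent), **`isMinOn_psiK_torus`** (ψ_k = aGQ(u)^*ψ is THE minimizer: minimizes, and uniquely), **`eq328_torus`**, **`eq464_torus`**
  ((3.28) and the Gaussian form of (4.6.4) with the printed exponent under the integral).
Scope (F6): one averaging level (k = 1 of §4.6; §3); the k-level average Q_k(u) along the composed contours (2.13) is not typed on the
torus (`-- TODO(general k)`); the transports of any contour built from bonds satisfy §1 verbatim.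
-/

open scoped RealInnerProductSpace BigOperators
open MeasureTheory Finset

namespace Literature.MathematicalPhysics.QuantumFieldTheory.BalabanImbrieJaffe1984to88.BIJ85ScalarPropagatorTorus

open Literature.MathematicalPhysics.QuantumFieldTheory.Balaban1983to89
open BIJ88Sect3Statements (U1 toC cfg covD)
open BIJ88RenormTransf311 (inBlock)
open BIJ85BlockAveragesTorus BIJ85ScalarForm464 BIJ85Eq461Proof

noncomputable section

variable {P : Params} {j : ℕ}

/-! ## §1 Transport along `Γ_{yx}` under `D_uφ = 0`; no zero modes -/

/-- `(D_uφ)_b = 0` read as the transport rule `u_bφ(b₊) = φ(b₋)` (c ≠ 0). [cite: BalabanImbrieJaffe1985, (1.1) p.300] -/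
theorem covD_eq_zero_iff {c : ℝ} (hc : c ≠ 0) (u : PBond P j → ℂ) (φ : Balaban1983to89.Site P j → ℂ) (b : PBond P j) :
    covD c u φ b = 0 ↔ u b * φ b.tgt = φ b.src := by
  unfold covD
  rw [mul_eq_zero, sub_eq_zero, or_iff_right]
  exact_mod_cast hc

/-- Transport along one leg of `Γ_{yx}`: if `u_bφ(b₊) = φ(b₋)` on every bond then `(Π_{t<n} u(legBond x μ t))·φ(legSite x μ n) =
φ(legSite x μ 0)` (the legs are consecutive, `legBond_tgt`). [cite: BalabanImbrieJaffe1985, (2.5) p.302] -/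
theorem prod_legBond_mul_eq {U : GaugeField P j U1} {φ : Balaban1983to89.Site P j → ℂ}
    (hcov : ∀ b : PBond P j, toC (U b) * φ b.tgt = φ b.src) (x : Balaban1983to89.Site P j) (μ : Fin P.d) :
    ∀ n : ℕ, (∏ t ∈ range n, toC (U (legBond x μ t))) * φ (legSite x μ n) = φ (legSite x μ 0)
  | 0 => by rw [prod_range_zero, one_mul]
  | n + 1 => by
    rw [prod_range_succ, mul_assoc, ← legBond_tgt x μ n, hcov (legBond x μ n)]
    exact prod_legBond_mul_eq hcov x μ n

/-- **`u(Γ_{yx})φ(x) = φ(y)`** for the corner `y` of the block of `x`, whenever `D_uφ = 0` (transport leg by leg from `x` back to the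
corner; standing range). [cite: BalabanImbrieJaffe1985, (2.6) p.303] -/
theorem holC_mul_eq_corner (hj : j + 1 ≤ P.m + P.K) {U : GaugeField P j U1} {φ : Balaban1983to89.Site P j → ℂ}
    (hcov : ∀ b : PBond P j, toC (U b) * φ b.tgt = φ b.src) (x : Balaban1983to89.Site P j) :
    holC U x * φ x = φ (corner (blockOf x)) := by
  have step : ∀ μ : Fin P.d, legProd U x μ * φ (junction x μ) = φ (junction x (μ + 1)) := by
    intro μ
    have h := prod_legBond_mul_eq hcov x μ (inBlock x μ)
    rw [legSite_inBlock hj, legSite_zero] at h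
    exact h
  set F : ℕ → ℂ := fun i => if h : i < P.d then legProd U x ⟨i, h⟩ else 1 with hF
  have hFμ : ∀ μ : Fin P.d, F μ = legProd U x μ := fun μ => by simp only [hF, μ.isLt, dif_pos]
  have tel : ∀ n : ℕ, n ≤ P.d → (∏ i ∈ range n, F i) * φ x = φ (junction x n) := by
    intro n
    induction n with
    | zero => intro _; rw [prod_range_zero, one_mul, junction_zero]
    | succ n ih =>
      intro hn
      have hn' : n < P.d := Nat.lt_of_succ_le hn
      rw [prod_range_succ, mul_comm (∏ i ∈ range n, F i) (F n), mul_assoc, ih hn'.le, hFμ ⟨n, hn'⟩]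
      exact step ⟨n, hn'⟩
  have hd := tel P.d le_rfl
  rw [junction_d] at hd
  have e : holC U x = ∏ i ∈ range P.d, F i := by
    unfold holC
    rw [← Fin.prod_univ_eq_prod_range F P.d]
    exact prod_congr rfl fun μ _ => (hFμ μ).symm
  rw [e, hd]

/-- **`(Q(u)φ)(y) = φ(y)`** (y the corner of B(y)) whenever `D_uφ = 0`: every term of (2.6) transports to the corner value, and
`|B(y)| = L^d` (`Site.card_block`). [cite: BalabanImbrieJaffe1985, (2.6) p.303] -/
theorem qCov_eq_corner (hj : j + 1 ≤ P.m + P.K) {U : GaugeField P j U1} {φ : Balaban1983to89.Site P j → ℂ}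
    (hcov : ∀ b : PBond P j, toC (U b) * φ b.tgt = φ b.src) (y : Balaban1983to89.Site P (j+1)) :
    qCov U φ y = φ (corner y) := by
  rw [qCov_apply]
  have h : ∀ x ∈ block y, holC U x * φ x = φ (corner y) := fun x hx => by
    rw [holC_mul_eq_corner hj hcov, mem_block_iff.1 hx]
  rw [sum_congr rfl h, sum_const, Balaban1983to89.Site.card_block hj, nsmul_eq_mul]
  push_cast
  have hL : ((P.L : ℂ) ^ P.d) ≠ 0 := pow_ne_zero _ (by exact_mod_cast P.L_pos.ne')
  rw [← mul_assoc, inv_mul_cancel₀ hL, one_mul]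

/-- **NO ZERO MODES of `−Δ_u + aQ(u)^*Q(u)`**: `D_uφ = 0` and `Q(u)φ = 0` force `φ = 0` — for EVERY `U(1)` gauge field `u` (the corner
values vanish by `qCov_eq_corner`, and `φ(x) = u(Γ_{yx})^{−1}φ(y)`).  This is the invertibility asserted in (4.6.2) (and (3.26)).
[cite: BalabanImbrieJaffe1985, (4.6.2) p.313] -/
theorem eq_zero_of_covD_eq_zero_of_qCov_eq_zero (hj : j + 1 ≤ P.m + P.K) {c : ℝ} (hc : c ≠ 0) {U : GaugeField P j U1}
    {φ : Balaban1983to89.Site P j → ℂ} (hD : ∀ b, covD c (cfg U) φ b = 0) (hQ : ∀ y, qCov U φ y = 0) : φ = 0 := by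
  have hcov : ∀ b : PBond P j, toC (U b) * φ b.tgt = φ b.src := fun b =>
    (covD_eq_zero_iff hc (cfg U) φ b).1 (hD b)
  funext x
  have h := holC_mul_eq_corner hj hcov x
  rw [← qCov_eq_corner hj hcov (blockOf x), hQ, mul_eq_zero] at h
  exact h.resolve_left (holC_ne_zero U x)

/-! ## §2 The field spaces as finite-dimensional real inner-product spaces; `D_u`, `Q(u)` as linear maps -/

/-- η-lattice (fine) scalar fields `φ : T_η → ℂ` with the ℓ² product. [cite: BalabanImbrieJaffe1985, (2.1) p.302] -/
abbrev FineSp (P : Params) (j : ℕ) : Type := PiLp 2 (fun _ : Balaban1983to89.Site P j => ℂ)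

/-- bond fields (values of `D_uφ`) with the ℓ² product. [cite: BalabanImbrieJaffe1985, (1.1) p.300] -/
abbrev BondSp (P : Params) (j : ℕ) : Type := PiLp 2 (fun _ : PBond P j => ℂ)

/-- unit-lattice (coarse) scalar fields `ψ` with the ℓ² product (weight 1 in (2.2)). [cite: BalabanImbrieJaffe1985, (2.2) p.302] -/
abbrev CoarseSp (P : Params) (j : ℕ) : Type := PiLp 2 (fun _ : Balaban1983to89.Site P (j+1) => ℂ)

/-- `D_u` as a real-linear map `φ ↦ (b ↦ c(u_bφ(b₊) − φ(b₋)))`. [cite: BalabanImbrieJaffe1985, (4.6.3) p.313] -/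
def Dlin (c : ℝ) (U : GaugeField P j U1) : FineSp P j →ₗ[ℝ] BondSp P j where
  toFun φ := WithLp.toLp 2 (covD c (cfg U) (WithLp.ofLp φ))
  map_add' φ φ' := by
    ext b
    simp only [PiLp.add_apply, covD]
    ring
  map_smul' r φ := by
    ext b
    simp only [PiLp.smul_apply, covD, RingHom.id_apply, Complex.real_smul]
    ring

/-- `Q(u)` of (2.6) as a real-linear map. [cite: BalabanImbrieJaffe1985, (2.6) p.303] -/
def Qlin (U : GaugeField P j U1) : FineSp P j →ₗ[ℝ] CoarseSp P j where
  toFun φ := WithLp.toLp 2 (qCov U (WithLp.ofLp φ))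
  map_add' φ φ' := by
    ext y
    simp only [PiLp.add_apply, qCov_apply, WithLp.ofLp_add, Pi.add_apply, mul_add, sum_add_distrib]
  map_smul' r φ := by
    ext y
    simp only [PiLp.smul_apply, qCov_apply, WithLp.ofLp_smul, Pi.smul_apply, RingHom.id_apply, Complex.real_smul,
      mul_sum]
    exact sum_congr rfl fun x _ => by ring

/-- kernel: the value of `Dlin`. [cite: BalabanImbrieJaffe1985, (4.6.3) p.313] -/
@[simp] theorem Dlin_apply (c : ℝ) (U : GaugeField P j U1) (φ : FineSp P j) (b : PBond P j) :
    Dlin c U φ b = covD c (cfg U) (WithLp.ofLp φ) b := rfl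

/-- kernel: the value of `Qlin`. [cite: BalabanImbrieJaffe1985, (2.6) p.303] -/
@[simp] theorem Qlin_apply (U : GaugeField P j U1) (φ : FineSp P j) (y : Balaban1983to89.Site P (j+1)) :
    Qlin U φ y = qCov U (WithLp.ofLp φ) y := rfl

/-- `‖D_uφ‖² = Σ_b |c(u_bφ(b₊) − φ(b₋))|²`. [cite: BalabanImbrieJaffe1985, (4.6.3) p.313] -/
theorem norm_Dlin_sq (c : ℝ) (U : GaugeField P j U1) (φ : FineSp P j) :
    ‖Dlin c U φ‖ ^ 2 = ∑ b : PBond P j, ‖(c : ℂ) * (toC (U b) * φ b.tgt - φ b.src)‖ ^ 2 := by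
  rw [PiLp.norm_sq_eq_of_L2]
  rfl

/-- `‖Q(u)φ − ψ‖² = Σ_y |(Q(u)φ)(y) − ψ(y)|²`. [cite: BalabanImbrieJaffe1985, (2.6) p.303] -/
theorem norm_Qlin_sub_sq (U : GaugeField P j U1) (φ : FineSp P j) (ψ : CoarseSp P j) :
    ‖Qlin U φ - ψ‖ ^ 2 = ∑ y : Balaban1983to89.Site P (j+1), ‖qCov U (WithLp.ofLp φ) y - ψ y‖ ^ 2 := by
  rw [PiLp.norm_sq_eq_of_L2]
  rfl

/-- The abstract form (3.25)/(the exponent of (4.6.1) with source ψ) of `BIJ85ScalarForm464` IS the printed expression on the torus: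
`½aΣ_y|(Q(u)φ)(y) − ψ(y)|² + ½Σ_b|c(u_bφ(b₊) − φ(b₋))|²`. [cite: BalabanImbrieJaffe1985, (3.25) p.308] -/
theorem scalarForm_torus (c a : ℝ) (U : GaugeField P j U1) (ψ : CoarseSp P j) (φ : FineSp P j) :
    scalarForm (Dlin c U) (Qlin U) a ψ φ
      = (1 / 2 : ℝ) * a * (∑ y : Balaban1983to89.Site P (j+1), ‖qCov U (WithLp.ofLp φ) y - ψ y‖ ^ 2)
        + (1 / 2 : ℝ) * ∑ b : PBond P j, ‖(c : ℂ) * (toC (U b) * φ b.tgt - φ b.src)‖ ^ 2 := by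
  rw [scalarForm, norm_Qlin_sub_sq, norm_Dlin_sq]

/-! ## §3 `hpos` discharged; (4.6.1)/(4.6.2), the minimizer ψ_k, (3.28), (4.6.4) for the printed operators -/

/-- **The convergence condition of (4.6.1) HOLDS on the torus**: for every `U(1)` gauge field `u`, every `a > 0` and `c ≠ 0`,
`‖D_uφ‖² + a‖Q(u)φ‖² > 0` for `φ ≠ 0` (= the hypothesis `hpos` of `BIJ85Eq461Proof.exists_inverse`/`eq461`, discharged by §1).
[cite: BalabanImbrieJaffe1985, (4.6.2) p.313] -/
theorem hpos_torus (hj : j + 1 ≤ P.m + P.K) {c : ℝ} (hc : c ≠ 0) {a : ℝ} (ha : 0 < a) (U : GaugeField P j U1) :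
    ∀ φ : FineSp P j, φ ≠ 0 → 0 < ‖Dlin c U φ‖ ^ 2 + a * ‖Qlin U φ‖ ^ 2 := by
  intro φ hφ
  have h1 : 0 ≤ ‖Dlin c U φ‖ ^ 2 := by positivity
  have h2 : 0 ≤ a * ‖Qlin U φ‖ ^ 2 := by positivity
  rcases (add_nonneg h1 h2).lt_or_eq with h | h
  · exact h
  · exfalso
    have hD0 : ‖Dlin c U φ‖ ^ 2 = 0 := by linarith
    have hQ0 : ‖Qlin U φ‖ ^ 2 = 0 := by nlinarith
    rw [sq_eq_zero_iff, norm_eq_zero] at hD0 hQ0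
    apply hφ
    have hz := eq_zero_of_covD_eq_zero_of_qCov_eq_zero hj hc (U := U) (φ := WithLp.ofLp φ)
      (fun b => by rw [← Dlin_apply, hD0, PiLp.zero_apply]) (fun y => by rw [← Qlin_apply, hQ0, PiLp.zero_apply])
    exact (WithLp.ofLp_eq_zero (p := 2)).1 hz

/-- **(4.6.2)/(3.26) on the torus: `G = [D_u^*D_u + aQ(u)^*Q(u)]^{−1}` EXISTS** (two-sided inverse), for every gauge field `u`, `a > 0`,
`c ≠ 0` — `BIJ85Eq461Proof.exists_inverse` with `hpos` discharged. [cite: BalabanImbrieJaffe1985, (4.6.2) p.313] -/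
theorem exists_G (hj : j + 1 ≤ P.m + P.K) {c : ℝ} (hc : c ≠ 0) {a : ℝ} (ha : 0 < a) (U : GaugeField P j U1) :
    ∃ G : FineSp P j →ₗ[ℝ] FineSp P j,
      (∀ φ, opT (Dlin c U) (Qlin U) a (G φ) = φ) ∧ ∀ φ, G (opT (Dlin c U) (Qlin U) a φ) = φ :=
  exists_inverse (Dlin c U) (Qlin U) a (hpos_torus hj hc ha U)

/-- **(4.6.1) on the torus, no hypothesis left**: for every gauge field `u`, `a > 0`, `c ≠ 0` and THE inverse `G` of (4.6.2),
`exp(½⟨h, Gh⟩) = Z^{−1}∫𝒟φ exp[−½‖D_uφ‖² − ½a‖Q(u)φ‖² + ⟨φ, h⟩]` — `BIJ85Eq461Proof.eq461` with `hpos` discharged.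
[cite: BalabanImbrieJaffe1985, (4.6.1) p.313] -/
theorem eq461_torus (hj : j + 1 ≤ P.m + P.K) {c : ℝ} (hc : c ≠ 0) {a : ℝ} (ha : 0 < a) (U : GaugeField P j U1)
    (G : FineSp P j →ₗ[ℝ] FineSp P j) (hG : ∀ φ, opT (Dlin c U) (Qlin U) a (G φ) = φ) (h : FineSp P j) :
    Real.exp ((1 / 2 : ℝ) * ⟪h, G h⟫)
      = (∫ φ : FineSp P j, Real.exp (-(1 / 2 : ℝ) * ‖Dlin c U φ‖ ^ 2 - (1 / 2 : ℝ) * a * ‖Qlin U φ‖ ^ 2))⁻¹ *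
        ∫ φ : FineSp P j, Real.exp (-(1 / 2 : ℝ) * ‖Dlin c U φ‖ ^ 2 - (1 / 2 : ℝ) * a * ‖Qlin U φ‖ ^ 2 + ⟪φ, h⟫) :=
  eq461 (Dlin c U) (Qlin U) a (hpos_torus hj hc ha U) G hG h

/-- **p. 313: `ψ_k = a_kG_k(u_k)Q_k^*(u_k)ψ` is THE η-lattice minimizer**, on the torus: for every gauge field `u`, `a > 0`, `c ≠ 0` and
the inverse `G` of (4.6.2), `phiCl` (= aGQ(u)^*ψ) minimizes the printed form ½aΣ|Q(u)φ − ψ|² + ½Σ|D_uφ|² over all φ AND is its only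
minimizer (`BIJ85ScalarForm464.isMinOn_phiCl` + `eq_phiCl_of_isMinOn`, `hpos` discharged). [cite: BalabanImbrieJaffe1985, (4.6.4) p.313] -/
theorem isMinOn_psiK_torus (hj : j + 1 ≤ P.m + P.K) {c : ℝ} (hc : c ≠ 0) {a : ℝ} (ha : 0 < a) (U : GaugeField P j U1)
    {G : FineSp P j →ₗ[ℝ] FineSp P j} (hG : ∀ φ, opT (Dlin c U) (Qlin U) a (G φ) = φ) (ψ : CoarseSp P j) :
    IsMinOn (scalarForm (Dlin c U) (Qlin U) a ψ) Set.univ (phiCl (Qlin U) a G ψ) ∧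
      ∀ φ, IsMinOn (scalarForm (Dlin c U) (Qlin U) a ψ) Set.univ φ → φ = phiCl (Qlin U) a G ψ :=
  ⟨isMinOn_phiCl hG ha.le ψ, fun _ hmin => eq_phiCl_of_isMinOn hG (hpos_torus hj hc ha U) hmin⟩

/-- **(3.28) on the torus** for the printed Q(u), D_u: the form at φ_cl + φ_fl splits as ½⟨φ_fl, G^{−1}φ_fl⟩ + ½a⟨ψ,[I − aQGQ^*]ψ⟩
(`BIJ85ScalarForm464.eq328`; any right inverse G, in particular THE inverse of `exists_G`). [cite: BalabanImbrieJaffe1985, (3.28) p.308] -/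
theorem eq328_torus (c a : ℝ) (U : GaugeField P j U1) {G : FineSp P j →ₗ[ℝ] FineSp P j}
    (hG : ∀ φ, opT (Dlin c U) (Qlin U) a (G φ) = φ) (ψ : CoarseSp P j) (χ : FineSp P j) :
    scalarForm (Dlin c U) (Qlin U) a ψ (phiCl (Qlin U) a G ψ + χ)
      = (1 / 2 : ℝ) * ⟪χ, opT (Dlin c U) (Qlin U) a χ⟫
        + (1 / 2 : ℝ) * a * ⟪ψ, ((LinearMap.id : CoarseSp P j →ₗ[ℝ] CoarseSp P j)
            - a • (Qlin U ∘ₗ G ∘ₗ (Qlin U).adjoint)) ψ⟫ :=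
  eq328 hG ψ χ

/-- **(4.6.4) on the torus, Gaussian form with the PRINTED exponent**: `∫𝒟φ exp[−½aΣ_y|(Q(u)φ)(y) − ψ(y)|² − ½Σ_b|c(u_bφ(b₊) − φ(b₋))|²]
= exp(−½⟨ψ, Δ(u)ψ⟩)·∫𝒟φ exp(−½⟨φ, G^{−1}φ⟩)`, Δ(u) = aI − a²Q(u)GQ(u)^* (`BIJ85ScalarForm464.deltaOp`) — *"The quadratic form which
arises for the scalar field is ⟨ψ, Δ_k(u_k)ψ⟩"*. [cite: BalabanImbrieJaffe1985, (4.6.4) p.313] -/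
theorem eq464_torus (c a : ℝ) (U : GaugeField P j U1) {G : FineSp P j →ₗ[ℝ] FineSp P j}
    (hG : ∀ φ, opT (Dlin c U) (Qlin U) a (G φ) = φ) (ψ : CoarseSp P j) :
    ∫ φ : FineSp P j, Real.exp (-((1 / 2 : ℝ) * a * (∑ y : Balaban1983to89.Site P (j+1), ‖qCov U (WithLp.ofLp φ) y - ψ y‖ ^ 2)
        + (1 / 2 : ℝ) * ∑ b : PBond P j, ‖(c : ℂ) * (toC (U b) * φ b.tgt - φ b.src)‖ ^ 2))
      = Real.exp (-((1 / 2 : ℝ) * ⟪ψ, deltaOp (Qlin U) a G ψ⟫))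
        * ∫ φ : FineSp P j, Real.exp (-((1 / 2 : ℝ) * ⟪φ, opT (Dlin c U) (Qlin U) a φ⟫)) := by
  simp_rw [← scalarForm_torus]
  exact eq464_gaussian hG ψ

/-- **(4.6.4), the infimum, on the torus**: `½⟨ψ, Δ(u)ψ⟩ ≤ ½aΣ|Q(u)φ − ψ|² + ½Σ|D_uφ|²` for all φ, `a ≥ 0` (`BIJ85ScalarForm464.eq464_inf`).
[cite: BalabanImbrieJaffe1985, (4.6.4) p.313] -/
theorem eq464_inf_torus (c : ℝ) {a : ℝ} (ha : 0 ≤ a) (U : GaugeField P j U1) {G : FineSp P j →ₗ[ℝ] FineSp P j}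
    (hG : ∀ φ, opT (Dlin c U) (Qlin U) a (G φ) = φ) (ψ : CoarseSp P j) (φ : FineSp P j) :
    (1 / 2 : ℝ) * ⟪ψ, deltaOp (Qlin U) a G ψ⟫
      ≤ (1 / 2 : ℝ) * a * (∑ y : Balaban1983to89.Site P (j+1), ‖qCov U (WithLp.ofLp φ) y - ψ y‖ ^ 2)
        + (1 / 2 : ℝ) * ∑ b : PBond P j, ‖(c : ℂ) * (toC (U b) * φ b.tgt - φ b.src)‖ ^ 2 := by
  rw [← scalarForm_torus]
  exact eq464_inf hG ha ψ φ

end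

end Literature.MathematicalPhysics.QuantumFieldTheory.BalabanImbrieJaffe1984to88.BIJ85ScalarPropagatorTorus
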